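import Literature.AlgebraicTopology.CharacteristicClasses.Complexification
import HarnessLib

/-!
# Stability of the Pontryagin classes: `p(V ⊕ ε) = p(V)`, `p(ε) = 1`

Topic `Literature/AlgebraicTopology/CharacteristicClasses`.  F. Hirzebruch, *Topological Methods in
Algebraic Geometry* (3rd ed. 1966), §4.5 (pp. 65–66): the Pontrjagin classes
`pᵢ(ξ) = (-1)ⁱ c₂ᵢ(ψ(ξ))` of a real bundle (the tree's `pontryaginClass`, `Complexification.lean`)
satisfy II) naturality and III) the product formula modulo `2`-torsion; in particular — exactly,
not only modulo torsion, since `c(ψ(ε)) = 1` — **`p(ξ ⊕ ε) = p(ξ)` for a trivial bundle `ε`**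
(Milnor–Stasheff §15, Lemma 15.2's proof / p. 175: "`p(ξ ⊕ ε) = p(ξ)`").  This is the input
"`p(TW|∂W) = p(T∂W ⊕ ε¹) = p(T∂W)`" of the bordism invariance of Pontryagin numbers (Hirzebruch
Thm. 8.2.2's proof via Thom).  Contents, all proved:

* `chernClassZ_directSum_eq_left/right` — (C₂) when one summand has vanishing positive Chern
  classes: `c_m(ξ ⊕ η) = c_m(ξ)`;
* `Complexification.trivialIso : (B × F) ⊗ ℂ ≅ B × ℂⁿ` (fibrewise `toModelC`),
  `chernClassZ_complexified_trivial`, **`pontryaginClass_trivial : pᵢ(ε) = 0` (`i > 0`)**;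
* **`pontryaginClass_prod_trivial : pᵢ(V ⊕ ε) = pᵢ(V)`**, `pontryaginClass_trivial_prod :
  pᵢ(ε ⊕ V) = pᵢ(V)` (Mathlib's fibrewise product with `Bundle.Trivial B F₂`), over paracompact
  Hausdorff bases.

No named facts.

## References

* F. Hirzebruch, *Topological Methods in Algebraic Geometry*, 3rd ed., Springer (1966), §4.5
  II)–III) (pp. 65–66). [Hirzebruch1966]
* J. Milnor, J. Stasheff, *Characteristic Classes*, Ann. of Math. Stud. 76 (1974), §15
  (p. 175). [MilnorStasheffAMS76]
* D. Husemoller, *Fibre Bundles*, 3rd ed., GTM 20 (1994), Ch. 17 §3 (C₂), Prop. 4.1. [HusemollerFibreBundles1994]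
-/

noncomputable section

open Bundle Topology Module Set Function Literature.AlgebraicTopology.SingularHomology

namespace Literature.AlgebraicTopology.CharacteristicClasses

/-! ### Whitney sum with a bundle whose positive Chern classes vanish -/

section DirectSumTrivial

variable {B : Type} [TopologicalSpace B] [T2Space B] [ParacompactSpace B]

/-- (C₂) with a factor of trivial Chern classes: if `c_b(η) = 0` for all `b > 0` then
`c_m(ξ ⊕ η) = c_m(ξ)` (only the term `c_m(ξ) ⌣ c₀(η) = c_m(ξ) ⌣ 1` of the Whitney sum survives).
[cite: HusemollerFibreBundles1994, Ch. 17 §3 (C₂) and Prop. 4.1] -/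
theorem chernClassZ_directSum_eq_left (E₁ E₂ : ComplexVectorBundle.{0, 0} B)
    (h : ∀ b, 0 < b → chernClassZ E₂ b = 0) (m : ℕ) :
    chernClassZ (E₁.directSum E₂) m = chernClassZ E₁ m := by
  refine (theChernClassTheory.chernClass_directSum E₁ E₂ m).trans ?_
  rw [Finset.sum_eq_single ⟨(m, 0), by simp⟩]
  · change cupEven _ (chernClassZ E₁ m) (chernClassZ E₂ 0) = chernClassZ E₁ m
    rw [chernClassZ_zero]
    exact cupProduct_one _
  · rintro ⟨⟨a, b⟩, hab⟩ - hne
    have hab' : a + b = m := Finset.HasAntidiagonal.mem_antidiagonal.mp hab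
    have hb : 0 < b := by
      rcases Nat.eq_zero_or_pos b with rfl | hb
      · exact absurd (Subtype.ext (by simp [← hab'])) hne
      · exact hb
    change cupEven _ (chernClassZ E₁ a) (chernClassZ E₂ b) = 0
    rw [h b hb, map_zero]
  · intro hm
    exact absurd (Finset.mem_univ _) hm

/-- Symmetric version: if `c_a(ξ) = 0` for all `a > 0` then `c_m(ξ ⊕ η) = c_m(η)`.
[cite: HusemollerFibreBundles1994, Ch. 17 §3 (C₂) and Prop. 4.1] -/
theorem chernClassZ_directSum_eq_right (E₁ E₂ : ComplexVectorBundle.{0, 0} B)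
    (h : ∀ a, 0 < a → chernClassZ E₁ a = 0) (m : ℕ) :
    chernClassZ (E₁.directSum E₂) m = chernClassZ E₂ m := by
  refine (theChernClassTheory.chernClass_directSum E₁ E₂ m).trans ?_
  rw [Finset.sum_eq_single ⟨(0, m), by simp⟩]
  · change cupEven _ (chernClassZ E₁ 0) (chernClassZ E₂ m) = chernClassZ E₂ m
    rw [chernClassZ_zero]
    exact one_cupProduct _
  · rintro ⟨⟨a, b⟩, hab⟩ - hne
    have hab' : a + b = m := Finset.HasAntidiagonal.mem_antidiagonal.mp hab
    have ha : 0 < a := by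
      rcases Nat.eq_zero_or_pos a with rfl | ha
      · exact absurd (Subtype.ext (by simp [← hab'])) hne
      · exact ha
    change cupEven _ (chernClassZ E₁ a) (chernClassZ E₂ b) = 0
    rw [h a ha, map_zero, LinearMap.zero_apply]
  · intro hm
    exact absurd (Finset.mem_univ _) hm

end DirectSumTrivial

/-! ### The complexification of a trivial bundle is trivial; `pᵢ(ε) = 0` -/

section Trivial

open Complexification

variable (B : Type) [TopologicalSpace B] (F : Type) [NormedAddCommGroup F] [NormedSpace ℝ F] [FiniteDimensional ℝ F]

/-- **`(B × F) ⊗ ℂ ≅ B × ℂⁿ`**: the complexification of the trivial real bundle with fibre `F` is the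
trivial complex bundle with fibre `ℂⁿ`, `n = dim F` (fibrewise the model isomorphism
`F ⊗ ℂ ≅ ℂⁿ`, `toModelC`). [cite: Hirzebruch1966, §4.5 (p. 65)] -/
def Complexification.trivialIso :
    (complexified F (Bundle.Trivial B F)).Iso (ComplexVectorBundle.trivial B (CModel F)) where
  equiv _ := toModelC F
  continuous_toFun := by
    refine (Bundle.Trivial.homeomorphProd B (CModel F)).isInducing.continuous_iff.2 ?_
    change Continuous fun p : TotalSpace (CModel F) (fun x ↦ Complexification (Bundle.Trivial B F x)) ↦
      (p.proj, toModel F ((reTotal F (Bundle.Trivial B F) p).2, (imTotal F (Bundle.Trivial B F) p).2))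
    refine (FiberBundle.continuous_proj (CModel F) (fun x ↦ Complexification (Bundle.Trivial B F x))).prodMk
      ((toModel F).continuous.comp (Continuous.prodMk ?_ ?_))
    · exact (continuous_snd.comp (Bundle.Trivial.homeomorphProd B F).continuous).comp
        (continuous_reTotal F (Bundle.Trivial B F))
    · exact (continuous_snd.comp (Bundle.Trivial.homeomorphProd B F).continuous).comp
        (continuous_imTotal F (Bundle.Trivial B F))
  continuous_invFun := by
    have h2 : Continuous fun q : TotalSpace (CModel F) (Bundle.Trivial B (CModel F)) ↦ (toModel F).symm q.2 :=
      (toModel F).symm.continuous.comp (continuous_snd.comp (Bundle.Trivial.homeomorphProd B (CModel F)).continuous)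
    have h1 : Continuous fun q : TotalSpace (CModel F) (Bundle.Trivial B (CModel F)) ↦ q.proj :=
      continuous_fst.comp (Bundle.Trivial.homeomorphProd B (CModel F)).continuous
    refine (Complexification.continuous_total_iff F (Bundle.Trivial B F) _).2 ⟨?_, ?_⟩
    · refine (Bundle.Trivial.homeomorphProd B F).isInducing.continuous_iff.2 ?_
      exact (h1.prodMk (continuous_fst.comp h2) :)
    · refine (Bundle.Trivial.homeomorphProd B F).isInducing.continuous_iff.2 ?_
      exact (h1.prodMk (continuous_snd.comp h2) :)

/-- **The Chern classes of the complexified trivial bundle vanish in positive degrees.** [cite: Hirzebruch1966, §4.5 (p. 65)] -/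
theorem chernClassZ_complexified_trivial [T2Space B] [ParacompactSpace B] {j : ℕ} (hj : 0 < j) :
    chernClassZ (complexified F (Bundle.Trivial B F)) j = 0 :=
  (theChernClassTheory.chernClass_congr (Complexification.trivialIso B F) j).trans
    (theChernClassTheory.chernClass_trivial (CModel F) hj)

/-- **`pᵢ(ε) = 0` for `i > 0`: the Pontryagin classes of a trivial real bundle vanish** (Hirzebruch
§4.5: `p(trivial) = 1`). [cite: Hirzebruch1966, §4.5 (p. 65)] -/
theorem pontryaginClass_trivial [T2Space B] [ParacompactSpace B] {i : ℕ} (hi : 0 < i) :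
    pontryaginClass F (Bundle.Trivial B F) i = 0 := by
  rw [pontryaginClass_def, chernClassZ_complexified_trivial B F (by omega), map_zero]
  exact zsmul_zero _

end Trivial

/-! ### Stability: `p(V ⊕ ε) = p(V)` -/

section Stability

open Complexification

variable {B : Type} [TopologicalSpace B] [T2Space B] [ParacompactSpace B]
  (F₁ : Type) [NormedAddCommGroup F₁] [NormedSpace ℝ F₁] [FiniteDimensional ℝ F₁]
  (V : B → Type) [TopologicalSpace (TotalSpace F₁ V)] [∀ x, AddCommGroup (V x)] [∀ x, Module ℝ (V x)]
  [∀ x, TopologicalSpace (V x)] [FiberBundle F₁ V] [VectorBundle ℝ F₁ V]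
  (F₂ : Type) [NormedAddCommGroup F₂] [NormedSpace ℝ F₂] [FiniteDimensional ℝ F₂]

/-- **Stability of the Pontryagin classes under trivial summands: `pᵢ(V ⊕ ε) = pᵢ(V)`**
(Hirzebruch §4.5 III) with `p(ε) = 1`; Milnor–Stasheff Lemma 15.2… `p(ξ ⊕ ε) = p(ξ)`).
[cite: Hirzebruch1966, §4.5 III) (p. 66)] -/
theorem pontryaginClass_prod_trivial (i : ℕ) :
    pontryaginClass (F₁ × F₂) (fun x ↦ V x × Bundle.Trivial B F₂ x) i = pontryaginClass F₁ V i := by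
  have h := theChernClassTheory.chernClass_congr (Complexification.prodIso F₁ V F₂ (Bundle.Trivial B F₂)) (2 * i)
  change chernClassZ _ (2 * i) = chernClassZ _ (2 * i) at h
  rw [pontryaginClass_def, pontryaginClass_def, h,
    chernClassZ_directSum_eq_left _ _ (fun b hb ↦ chernClassZ_complexified_trivial B F₂ hb)]

/-- **`pᵢ(ε ⊕ V) = pᵢ(V)`** (trivial summand on the left). [cite: Hirzebruch1966, §4.5 III) (p. 66)] -/
theorem pontryaginClass_trivial_prod (i : ℕ) :
    pontryaginClass (F₂ × F₁) (fun x ↦ Bundle.Trivial B F₂ x × V x) i = pontryaginClass F₁ V i := by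
  have h := theChernClassTheory.chernClass_congr (Complexification.prodIso F₂ (Bundle.Trivial B F₂) F₁ V) (2 * i)
  change chernClassZ _ (2 * i) = chernClassZ _ (2 * i) at h
  rw [pontryaginClass_def, pontryaginClass_def, h,
    chernClassZ_directSum_eq_right _ _ (fun a ha ↦ chernClassZ_complexified_trivial B F₂ ha)]

end Stability

end Literature.AlgebraicTopology.CharacteristicClasses
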